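import Mathlib
import HarnessLib
import Literature.Probability.Percolation.MeanFieldBetaFromGamma
import Summits.CriticalPhenomena.PercolationContinuityZ3.Theses.PercTruncatedSusceptibility

/-!
# Strategist sketch (NOT a line: no stubs) for crux `CritTruncatedSusceptibilityInfinite` (stmt-CriticalPhenomena-0850)

Typed forms of the statements examined in `STRATEGY-CENSUS.md` (transfer / strengthen /
decomposition / negation), stated def-free over tree declarations, plus the two glue
implications that ARE provable outright (the "supercritical pincer" `A1 → A2w → H` and the
excluded-middle split `Hcont → Hjump → H`). Nothing here is registered as a line: the census
explains why none of the open pieces exposes a tool. `lean check` rc 0, no `sorry`.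
-/

noncomputable section

open MeasureTheory Filter Topology
open scoped ENNReal

namespace Summit.CriticalPhenomena.PercolationContinuityZ3.Cruxes.CritTruncatedSusceptibilityInfinite.Strategist

open Literature.Probability.Percolation Literature.Probability.LatticeModels

/-- Shorthand: the bond-percolation measure on `ℤ³` at parameter `p`, as a real set function. -/
abbrev P (p : unitInterval) (A : Set (BondConfig (Site 3))) : ℝ :=
  (bondPercolation (zdGraph 3) p).real A

/-- `p_c(ℤ³)` as a point of `[0,1]`. -/
abbrev pc : unitInterval := criticalProbI 3

/-- The truncated two-point function `τ^f_p(0,x) = P_p(0 ↔ x, |C(0)| < ∞)`. -/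
abbrev tauF (p : unitInterval) (x : Site 3) : ℝ := P p (openConn 0 x \ percolatesAt 0)

/-- The truncated susceptibility `χ^f(p) = Σ_x τ^f_p(0,x) ∈ [0, ∞]` (no junk value). -/
abbrev chiF (p : unitInterval) : ℝ≥0∞ := ∑' x : Site 3, ENNReal.ofReal (tauF p x)

/-- The crux, by name. -/
abbrev H : Prop :=
  Summit.CriticalPhenomena.PercolationContinuityZ3.Theses.PercTruncatedSusceptibility.CritTruncatedSusceptibilityInfinite

/-! ## Transfer (birth's `C⁺`) — the converse shadow making `C⁺ ⟺ H` -/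

/-- CONVERSE SHADOW (provable, M-sized; thinning `p_c → p` keeps a `p_c`-cluster of size `≤ N`
intact with probability `≥ (p/p_c)^{3N} ≥ e^{-6/p_c}` when `p ≥ p_c - 1/N`, `N ≥ 2/p_c`): capped
cluster-size statistics in the `1/N`-window below `p_c` DOMINATE those at `p_c`. Together with
birth's `stub_sprinklingShadow` (the other direction) this makes `stub_subcritCappedMean_unbounded`
EQUIVALENT to `H`. -/
def ConverseShadow : Prop :=
  ∃ c : ℝ, 0 < c ∧ ∃ N₀ : ℕ, ∀ N k : ℕ, N₀ ≤ N → ∀ p : unitInterval,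
    (pc : ℝ) - 1 / (N : ℝ) ≤ (p : ℝ) → (p : ℝ) ≤ (pc : ℝ) →
      c * P pc (clusterSizeGe (0 : Site 3) k \ clusterSizeGe (0 : Site 3) (N + 1)) ≤
        P p (clusterSizeGe (0 : Site 3) k \ clusterSizeGe (0 : Site 3) (N + 1))

/-! ## Decomposition 1 — the supercritical pincer `H ⟺ A1 ∧ A2w` -/

/-- `A1` — divergence of the truncated susceptibility FROM ABOVE: `χ^f(p) → ∞` as `p ↓ p_c`
(Grimmett 1999 (9.4): `γ' > 0` "believed"; Heydenreich–van der Hofstad 2017 Open Problem 11.1).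
Strictly weaker than `H` (right lower semicontinuity of `χ^f`); false exactly in the RC-like jump
worlds (jump at `p_c`, finite clusters uniformly integrable from the right). -/
def A1_DivergenceFromAbove : Prop :=
  ∀ K : ℝ≥0∞, K < ⊤ → ∃ δ : ℝ, 0 < δ ∧ ∀ p : unitInterval,
    (pc : ℝ) < (p : ℝ) → (p : ℝ) < (pc : ℝ) + δ → K < chiF p

/-- `A2w` — the bridge `¬H → ¬A1` in its weakest usable form: if `τ^f_{p_c}` is summable then the
truncated susceptibility stays below some finite `K` at parameters arbitrarily close to `p_c` from
the right (uniform integrability of finite clusters as `p ↓ p_c`). False exactly in the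
"heavy-tailed jump worlds" (`χ^f(p_c) < ∞ = E_{p_c}[|C|²; |C| < ∞]`, where sprinkling suggests
`χ^f(p_c + ε) → ∞`). -/
def A2w_RightBoundedIfSummable : Prop :=
  Summable (fun x : Site 3 => tauF pc x) →
    ∃ K : ℝ≥0∞, K < ⊤ ∧ ∀ δ : ℝ, 0 < δ → ∃ p : unitInterval,
      (pc : ℝ) < (p : ℝ) ∧ (p : ℝ) < (pc : ℝ) + δ ∧ chiF p ≤ K

/-- GLUE of the pincer (proved): `A1 → A2w → H`. -/
theorem H_of_pincer (h1 : A1_DivergenceFromAbove) (h2 : A2w_RightBoundedIfSummable) : H := by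
  intro hsum
  obtain ⟨K, hK, hfreq⟩ := h2 hsum
  obtain ⟨δ, hδ, hall⟩ := h1 K hK
  obtain ⟨p, hp1, hp2, hle⟩ := hfreq δ hδ
  exact absurd (hall p hp1 hp2) (not_lt.2 hle)

/-! ## Decomposition 2 — excluded middle on the jump (recorded as COSTUME in the census) -/

/-- `Hcont`: in the continuous world `H` is the theorem `χ(p_c) = ∞` (Grimmett 1999 p. 266 /
Aizenman–Barsky + finite-size criterion). Provable now (M-sized: `χ(p_c) = ∞` in Lean + a.s.
identification of `{0 ↔ x} \ {|C| = ∞}` with `{0 ↔ x}` when `θ = 0`). -/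
def Hcont : Prop := theta (zdGraph 3) (0 : Site 3) pc = 0 → H

/-- `Hjump`: the whole open content — a jump at `p_c` forces infinite mean size of the finite
clusters AT `p_c` (Newman-genre "exponent inequality under a discontinuity hypothesis"). -/
def Hjump : Prop := 0 < theta (zdGraph 3) (0 : Site 3) pc → H

/-- GLUE (proved): `Hcont → Hjump → H`. -/
theorem H_of_em (hc : Hcont) (hj : Hjump) : H := by
  rcases (measureReal_nonneg : 0 ≤ theta (zdGraph 3) (0 : Site 3) pc).lt_or_eq with h | h
  · exact hj h
  · exact hc h.symm

/-! ## Strengthenings examined (signatures only; each is `≥ H`-strength in the jump world) -/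

/-- `X5` truncated volume tail: `P_{p_c}(n ≤ |C| < ∞) ≥ c/n` ("truncated `δ ≥ 1`"); with birth's
`stub_layerCake` it gives `H` (harmonic sum). -/
def X5_TruncVolumeTail : Prop :=
  ∃ c : ℝ, 0 < c ∧ ∀ n : ℕ, 1 ≤ n →
    c / (n : ℝ) ≤ P pc (clusterSizeGe (0 : Site 3) n \ percolatesAt 0)

/-- `X4` truncated one-arm not summable: `Σ_n P_{p_c}(0 ↔ ∂Λ_n, |C| < ∞) = ∞`
(`⟹ H` since `{0 ↔ ∂Λ_n} ⊆ {|C| ≥ n+1}` a.s. and `E[|C|; fin] = Σ_n P(|C| ≥ n, fin)`). -/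
def X4_TruncOneArmNotSummable : Prop :=
  ¬ Summable (fun n : ℕ => P pc (siteToBoundary 3 n \ percolatesAt 0))

/-- `S⁺_unif` quantitative capped mean, uniform in the window (the form an induction on the scale
`N` would need): `Σ_{k ≤ N} P_p(k ≤ |C| ≤ N) ≥ c log N` for all `p ∈ [p_c - 1/N, p_c]`. -/
def SplusUnif_CappedMeanLog : Prop :=
  ∃ c : ℝ, 0 < c ∧ ∃ N₀ : ℕ, ∀ N : ℕ, N₀ ≤ N → ∀ p : unitInterval,
    (pc : ℝ) - 1 / (N : ℝ) ≤ (p : ℝ) → (p : ℝ) ≤ (pc : ℝ) →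
      c * Real.log N ≤ ∑ k ∈ Finset.Icc 1 N,
        P p (clusterSizeGe (0 : Site 3) k \ clusterSizeGe (0 : Site 3) (N + 1))

/-- GLUE (proved): the uniform strengthening at `p = p_c` plus birth's `stub_layerCake` give `H`. -/
theorem H_of_SplusUnif
    (hCake : Summit.CriticalPhenomena.PercolationContinuityZ3.Cruxes.CritTruncatedSusceptibilityInfinite.Strategist.H ∨
      ∀ N : ℕ, Summable (fun x : Site 3 => tauF pc x) →
        ∑ k ∈ Finset.Icc 1 N, P pc (clusterSizeGe (0 : Site 3) k \ percolatesAt 0) ≤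
          ∑' x : Site 3, tauF pc x)
    (hmono : ∀ N k : ℕ, P pc (clusterSizeGe (0 : Site 3) k \ clusterSizeGe (0 : Site 3) (N + 1)) ≤
      P pc (clusterSizeGe (0 : Site 3) k \ percolatesAt 0))
    (hS : SplusUnif_CappedMeanLog) : H := by
  rcases hCake with h | hCake
  · exact h
  intro hsum
  obtain ⟨c, hc, N₀, hN⟩ := hS
  set T : ℝ := ∑' x : Site 3, tauF pc x with hT
  -- choose `N ≥ N₀`, `N ≥ 1` with `c log N > T`
  obtain ⟨N, hN₀, hN1, hbig⟩ : ∃ N : ℕ, N₀ ≤ N ∧ 1 ≤ N ∧ T < c * Real.log N := by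
    have htend : Tendsto (fun N : ℕ => c * Real.log N) atTop atTop :=
      (Real.tendsto_log_atTop.comp tendsto_natCast_atTop_atTop).const_mul_atTop hc
    have hev := (htend.eventually_gt_atTop T).and
      ((eventually_ge_atTop N₀).and (eventually_ge_atTop 1))
    obtain ⟨N, hNT, hNN₀, hN1⟩ := hev.exists
    exact ⟨N, hNN₀, hN1, hNT⟩
  have hwin : (pc : ℝ) - 1 / (N : ℝ) ≤ (pc : ℝ) := by
    have : (0 : ℝ) ≤ 1 / (N : ℝ) := by positivity
    linarith
  have h1 := hN N hN₀ pc hwin le_rfl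
  have h2 : ∑ k ∈ Finset.Icc 1 N, P pc (clusterSizeGe (0 : Site 3) k \ clusterSizeGe (0 : Site 3) (N + 1)) ≤
      ∑ k ∈ Finset.Icc 1 N, P pc (clusterSizeGe (0 : Site 3) k \ percolatesAt 0) :=
    Finset.sum_le_sum fun k _ => hmono N k
  have h3 := hCake N hsum
  linarith

/-! ## Negation — what the `¬H` world satisfies (the Aizenman–Barsky ghost-field pair at `p_c`
gives only this quantitative floor; recorded, not a stub) -/

/-- In the `¬H` world (`θ = θ(p_c) > 0`, `S = χ^f(p_c) < ∞`) the two Aizenman–Barsky differential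
inequalities (Grimmett 1999 Lemmas (5.51), (5.53)) at `(p_c, γ ↓ 0)` force only
`S ≥ (1 - θ)(1 - p_c)/(2d p_c θ)` (`d = 3`): a FLOOR on the truncated susceptibility in terms of
the jump, consistent with `¬H`. Typed for the record. -/
def ABFloor : Prop :=
  ∀ S : ℝ, HasSum (fun x : Site 3 => tauF pc x) S →
    (1 - theta (zdGraph 3) (0 : Site 3) pc) * (1 - (pc : ℝ)) ≤
      2 * 3 * (pc : ℝ) * theta (zdGraph 3) (0 : Site 3) pc * S

end Summit.CriticalPhenomena.PercolationContinuityZ3.Cruxes.CritTruncatedSusceptibilityInfinite.Strategist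

end
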